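import Summits.BirchSwinnertonDyer.BirchSwinnertonDyer.Theses.FrozenTwin
import Summits.BirchSwinnertonDyer.BirchSwinnertonDyer.Theses.SelmerRank
import Literature.NumberTheory.EllipticCurves.IwasawaLeadingTermProofs
import Literature.NumberTheory.EllipticCurves.BSDSelmer

/-!
# Line audit — line `IdeateR2K4` for crux `SelmerRankShaPFinite` (stmt-BirchSwinnertonDyer-0132)

Lead seat `prover-line-stmt-BirchSwinnertonDyer-0132-a1-0`, cycle 1 (route affinity FrozenTwin).
Crux (verbatim; the item's canonical decl is `Theses.SelmerRank.SelmerRankShaPFinite`, shared as the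
same term by ToricShedding / FrozenTwin / TangentCone / VerticalContact):
`∀ (W : WeierstrassCurve ℚ) [W.IsElliptic] (p : ℕ) [Fact p.Prime], Finite ↥(AddCommGroup.primaryComponent W.sha p)`.

The served "line" `IdeateR2K4.lean` registers no stub (gate: `FAIL skeleton.missing`). This file types
what registering it WOULD mean and why that is not a line (every theorem sorry-free; stubs appear as
HYPOTHESES so that nothing is registered on the item):

* §0 the FrozenTwin copy of the crux is the item's decl (same term).
* §1 `SelmerRankShaPFinite_of_split` — the only faithful skeletonisation of the r2k4 split: three stubs
  `PParityAll` (Dokchitser–Dokchitser 2010 Thm 1.4, tree fact `selmerCorank_mod_two_eq`, unproved in tree),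
  `MWParityAll` (Mordell–Weil parity for every `E/ℚ`, OPEN), `NoPhantomPair` (OPEN) ⟹ crux by name.
* §2 necessity — `split_iff_crux`: given stub 1, stubs 2 ∧ 3 are jointly EQUIVALENT to the crux; no stub
  set drawn from this line is easier than the crux itself.
* §3 `noPhantomPair_at_iff_rank_eq_analyticRank` — at the instance the routes consume (a prime with
  `corank_p Sel = r_an` in hand) stub 3 is literally `rank E(ℚ) = r_an(E)`; `one_le_rank_of_mwParityAll` —
  stub 2 alone contains "odd `r_an` ⇒ a point of infinite order" for every `E/ℚ`.
* §4 the consumed-exact restatement for the planner: `ShaPFiniteAtCertifiedPrime` (Ш[p^∞] finite at a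
  prime where `corank_p = r_an`, globally minimal model) is (a) a consequence of the summit
  (`shaPFiniteAtCertifiedPrime_of_bsd`) — the filed ∀E∀p crux is not — , (b) equivalent to the points
  lower bound on the certified locus (`shaPFiniteAtCertifiedPrime_iff_pointsLB`), and (c) SUFFICIENT for
  route FrozenTwin's deciding theorem: `closes_of_shaPFiniteAtCertifiedPrime` re-proves rev-5 `closes`
  with `SelmerRankShaPFinite` replaced by it (the non-minimal model `W` no longer needs its own Ш-instance:
  BSD-rank is transported from `C • W` by isomorphism invariance of rank and analytic rank).
-/

set_option linter.dupNamespace false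

namespace Summit.BirchSwinnertonDyer.BirchSwinnertonDyer.Cruxes.SelmerRankShaPFinite.IdeateR2K4LineAudit

open Summit.BirchSwinnertonDyer.BirchSwinnertonDyer.Theses
open Summit.BirchSwinnertonDyer.BirchSwinnertonDyer.Theses.FrozenTwin
open WeierstrassCurve Literature.NumberTheory.EllipticCurves

/-! ## §0 The route copy is the item's decl -/

/-- FrozenTwin's copy of the crux and the item's canonical decl (route SelmerRank) are the same term. -/
theorem frozenTwin_iff_selmerRank :
    FrozenTwin.SelmerRankShaPFinite ↔ SelmerRank.SelmerRankShaPFinite :=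
  Iff.rfl

/-! ## The r2k4 vocabulary (copied verbatim: `Cruxes/` modules are workfiles, not importable) -/

/-- Stub 1: `p`-parity for every `E/ℚ` and every prime (Dokchitser–Dokchitser 2010, Thm 1.4; tree fact
`selmerCorank_mod_two_eq`, unproved in tree). -/
def PParityAll : Prop :=
  ∀ (W : WeierstrassCurve ℚ) [W.IsElliptic] (p : ℕ) [Fact p.Prime], selmerCorank_mod_two_eq W p

/-- Stub 2: Mordell–Weil parity for every elliptic curve over `ℚ` (OPEN). -/
def MWParityAll : Prop :=
  ∀ (W : WeierstrassCurve ℚ) [W.IsElliptic], W.mordellWeilRank % 2 = W.analyticRank % 2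

/-- Stub 3: "no phantom pair" — an even phantom corank `t_p = corank_ℤₚ Ш(E/ℚ)[p^∞]` vanishes (OPEN). -/
def NoPhantomPair : Prop :=
  ∀ (W : WeierstrassCurve ℚ) [W.IsElliptic] (p : ℕ) [Fact p.Prime],
    Even (W.shaCorank p) → W.shaCorank p = 0

/-! ## §1 The only faithful skeletonisation: three stubs ⟹ the crux by name -/

/-- Composition of the would-be skeleton (`<Crux>_of`): stubs 1–3 give the crux BY NAME. -/
theorem SelmerRankShaPFinite_of_split (h₁ : PParityAll) (h₂ : MWParityAll) (h₃ : NoPhantomPair) :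
    SelmerRank.SelmerRankShaPFinite := by
  intro W _ p _
  rw [finite_primaryComponent_sha_iff_shaCorank_eq_zero W p]
  apply h₃ W p
  have a : W.selmerCorank p % 2 = W.analyticRank % 2 := h₁ W p
  have c : W.selmerCorank p = W.mordellWeilRank + W.shaCorank p :=
    W.selmerCorank_eq_mordellWeilRank_add_holds p
  have m : W.mordellWeilRank % 2 = W.analyticRank % 2 := h₂ W
  rw [Nat.even_iff]
  omega

/-! ## §2 Necessity: the open stubs are implied by the crux -/

/-- Stub 2 is implied by the crux (given stub 1): r2k4's `mwParityAll_of_crux`. -/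
theorem mwParityAll_of_crux (h₁ : PParityAll) (h : SelmerRank.SelmerRankShaPFinite) : MWParityAll := by
  intro W _
  haveI : Fact (Nat.Prime 2) := ⟨Nat.prime_two⟩
  have a : W.selmerCorank 2 % 2 = W.analyticRank % 2 := h₁ W 2
  have c : W.selmerCorank 2 = W.mordellWeilRank + W.shaCorank 2 :=
    W.selmerCorank_eq_mordellWeilRank_add_holds 2
  have z : W.shaCorank 2 = 0 := (finite_primaryComponent_sha_iff_shaCorank_eq_zero W 2).mp (h W 2)
  omega

/-- Stub 3 is implied by the crux (unconditionally). -/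
theorem noPhantomPair_of_crux (h : SelmerRank.SelmerRankShaPFinite) : NoPhantomPair :=
  fun W _ p _ _ => (finite_primaryComponent_sha_iff_shaCorank_eq_zero W p).mp (h W p)

/-- **The split is an equivalence**: given stub 1, stubs 2 ∧ 3 ⟺ the crux. So the would-be skeleton's
open stubs are jointly exactly as hard as the crux (r2k4's `crux_iff_mwParityAll_and_noPhantomPair`). -/
theorem split_iff_crux (h₁ : PParityAll) :
    (MWParityAll ∧ NoPhantomPair) ↔ SelmerRank.SelmerRankShaPFinite :=
  ⟨fun h => SelmerRankShaPFinite_of_split h₁ h.1 h.2,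
    fun h => ⟨mwParityAll_of_crux h₁ h, noPhantomPair_of_crux h⟩⟩

/-! ## §3 What each open stub is, concretely -/

/-- At the instance the routes consume — a curve `V` and a prime `p` with `corank_p Sel = r_an` already in
hand and MW parity at `V` — stub 3 at `(V, p)` is literally BSD-rank for `V`. -/
theorem noPhantomPair_at_iff_rank_eq_analyticRank (V : WeierstrassCurve ℚ) [V.IsElliptic] (p : ℕ)
    [Fact p.Prime] (hs : V.selmerCorank p = V.analyticRank)
    (hpar : V.mordellWeilRank % 2 = V.analyticRank % 2) :
    (Even (V.shaCorank p) → V.shaCorank p = 0) ↔ V.mordellWeilRank = V.analyticRank := by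
  have c : V.selmerCorank p = V.mordellWeilRank + V.shaCorank p :=
    V.selmerCorank_eq_mordellWeilRank_add_holds p
  rw [Nat.even_iff]
  omega

/-- Stub 2 alone contains a point-existence theorem for every `E/ℚ` of odd analytic rank (open for
`r_an ≥ 3`; Gross–Zagier–Kolyvagin is `r_an = 1`). -/
theorem one_le_rank_of_mwParityAll (h₂ : MWParityAll) (W : WeierstrassCurve ℚ) [W.IsElliptic]
    (hodd : Odd W.analyticRank) : 1 ≤ W.mordellWeilRank := by
  have m : W.mordellWeilRank % 2 = W.analyticRank % 2 := h₂ W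
  obtain ⟨k, hk⟩ := hodd
  omega

/-! ## §4 The consumed-exact restatement (planner information, D-0014) -/

/-- What the one-prime routes actually consume of the crux: `Ш(V/ℚ)[p^∞]` finite for a GLOBALLY MINIMAL
`V` at a prime `p` where `corank_ℤₚ Sel_p∞(V/ℚ) = r_an(V)` is already in hand. -/
def ShaPFiniteAtCertifiedPrime : Prop :=
  ∀ (V : WeierstrassCurve ℚ) [V.IsElliptic] [V.IsGloballyMinimal] (p : ℕ) [Fact p.Prime],
    V.selmerCorank p = V.analyticRank → Finite ↥(AddCommGroup.primaryComponent V.sha p)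

/-- The filed crux trivially implies the restatement. -/
theorem shaPFiniteAtCertifiedPrime_of_crux (h : SelmerRank.SelmerRankShaPFinite) :
    ShaPFiniteAtCertifiedPrime :=
  fun V _ _ p _ _ => h V p

/-- (a) The restatement is a CONSEQUENCE OF THE SUMMIT (`BirchSwinnertonDyer` = BSD-rank for every `E/ℚ`);
the filed ∀E∀p crux is not (it also asserts `corank_p Sel ≤ rank` at primes where no Selmer bound is known). -/
theorem shaPFiniteAtCertifiedPrime_of_bsd (hB : _root_.BirchSwinnertonDyer) : ShaPFiniteAtCertifiedPrime := by
  intro V hV _ p _ hs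
  rw [finite_primaryComponent_sha_iff_shaCorank_eq_zero V p]
  have c : V.selmerCorank p = V.mordellWeilRank + V.shaCorank p :=
    V.selmerCorank_eq_mordellWeilRank_add_holds p
  have b : V.analyticRank = V.mordellWeilRank := hB V hV
  omega

/-- (b) On the certified locus the restatement is EQUIVALENT to the points lower bound `r_an ≤ rank`
(the honest name of the difficulty: census `PointsLB`, restricted to the certified locus). -/
theorem shaPFiniteAtCertifiedPrime_iff_pointsLB :
    ShaPFiniteAtCertifiedPrime ↔
      ∀ (V : WeierstrassCurve ℚ) [V.IsElliptic] [V.IsGloballyMinimal] (p : ℕ) [Fact p.Prime],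
        V.selmerCorank p = V.analyticRank → V.analyticRank ≤ V.mordellWeilRank := by
  refine forall_congr' fun V => forall_congr' fun _ => forall_congr' fun _ => forall_congr' fun p =>
    forall_congr' fun _ => forall_congr' fun hs => ?_
  rw [finite_primaryComponent_sha_iff_shaCorank_eq_zero V p]
  have c : V.selmerCorank p = V.mordellWeilRank + V.shaCorank p :=
    V.selmerCorank_eq_mordellWeilRank_add_holds p
  omega

/-- (c) **The restatement suffices for route FrozenTwin.** Rev-5 `FrozenTwin.closes` re-proved with the
hypothesis `SelmerRankShaPFinite` replaced by `ShaPFiniteAtCertifiedPrime`; every other hypothesis and every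
step is the route file's own (Greenberg's identity, `shaCorank = 0` of finite Ш[p^∞], global minimal model,
isomorphism invariance T1–T3, the three one-prime sectors). The only change is the tail: BSD-rank is obtained on
the global minimal model `C • W` and transported to `W`, so no Ш-instance at the non-minimal model is needed. -/
theorem closes_of_shaPFiniteAtCertifiedPrime (hK1 : GrossMomentSharpness) (hK2 : FrozenTwinBound)
    (hPG : UBPotentiallyGood) (hLB : SelmerRankLB) (hSha : ShaPFiniteAtCertifiedPrime) (hCM : SelmerRankCM)
    (hSerre : SerrePrimeSupply) : _root_.BirchSwinnertonDyer := by
  have hId : ∀ (W : WeierstrassCurve ℚ), W.selmerCorank_eq_mordellWeilRank_add :=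
    fun W => W.selmerCorank_eq_mordellWeilRank_add_holds
  have hZ : ∀ (W : WeierstrassCurve ℚ) [W.IsElliptic] (p : ℕ) [Fact p.Prime],
      Finite ↥(AddCommGroup.primaryComponent W.sha p) → W.shaCorank p = 0 :=
    Literature.BSD.shaCorank_eq_zero_of_finite
  -- (T1) the Mordell–Weil rank is an isomorphism invariant
  have hMW : ∀ (W : WeierstrassCurve ℚ) (C : WeierstrassCurve.VariableChange ℚ),
      (C • W).mordellWeilRank = W.mordellWeilRank := fun W C =>
    @WeierstrassCurve.VariableChange.finrank_point_variableChange ℚ _ W C (Classical.decEq ℚ)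
  -- (T2) the local Euler factor is an isomorphism invariant
  have hloc : ∀ (R : Type) [CommRing R] [IsDomain R] [IsDiscreteValuationRing R]
      (K : Type) [Field K] [Algebra R K] [IsFractionRing R K]
      (W : WeierstrassCurve K) [W.IsElliptic] (C : WeierstrassCurve.VariableChange K),
      (C • W).localEulerFactor R = W.localEulerFactor R := by
    intro R _ _ _ K _ _ _ W _ C
    obtain ⟨D, hD⟩ : ∃ D : WeierstrassCurve.VariableChange K,
        (C • W).minimal R = D • W.minimal R :=
      ⟨((C • W).exists_isMinimal R).choose * C * ((W.exists_isMinimal R).choose)⁻¹, by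
        rw [WeierstrassCurve.minimal, WeierstrassCurve.minimal, mul_smul, mul_smul, inv_smul_smul]⟩
    haveI hE : (W.minimal R).IsElliptic := by rw [WeierstrassCurve.minimal]; infer_instance
    have hΔ : (W.minimal R).Δ ≠ 0 := (W.minimal R).isUnit_Δ.ne_zero
    have hgood : ((C • W).minimal R).HasGoodReduction R ↔ (W.minimal R).HasGoodReduction R := by
      rw [WeierstrassCurve.hasGoodReduction_iff, WeierstrassCurve.hasGoodReduction_iff,
        WeierstrassCurve.valuation_Δ_eq_of_isMinimal_of_eq_smul R hD]
      exact and_congr_left' ⟨fun _ => inferInstance, fun _ => inferInstance⟩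
    have hcard : Nat.card (((C • W).minimal R).reduction R).toAffine.Point =
        Nat.card ((W.minimal R).reduction R).toAffine.Point := by
      obtain ⟨E, hE⟩ := WeierstrassCurve.exists_reduction_eq_smul R hD hΔ
      rw [hE]
      exact WeierstrassCurve.natCard_point_smul _ _
    have hpoly : (C • W).localPolynomial R = W.localPolynomial R := by
      classical
      unfold WeierstrassCurve.localPolynomial
      simp only [hgood, hcard,
        WeierstrassCurve.hasSplitMultiplicativeReduction_iff_of_isMinimal_of_eq_smul R hD hΔ,
        WeierstrassCurve.hasMultiplicativeReduction_iff_of_isMinimal_of_eq_smul R hD hΔ]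
    simp only [WeierstrassCurve.localEulerFactor, WeierstrassCurve.localPowerSeries, hpoly]
  -- (T3) hence the analytic rank is an isomorphism invariant
  have hAn : ∀ (W : WeierstrassCurve ℚ) [W.IsElliptic] (C : WeierstrassCurve.VariableChange ℚ),
      (C • W).analyticRank = W.analyticRank := by
    intro W _ C
    have hL : (C • W).LFunction = W.LFunction := by
      unfold WeierstrassCurve.LFunction
      congr 1
      funext v
      simp only [WeierstrassCurve.baseChange, ← WeierstrassCurve.map_variableChange]
      exact hloc _ _ _ _
    have hLS : (C • W).LSeries = W.LSeries := by
      funext s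
      simp only [WeierstrassCurve.LSeries, hL]
    have hEC : (C • W).entireContinuations = W.entireContinuations := by
      simp only [WeierstrassCurve.entireContinuations, hLS]
    have hEL : (C • W).entireLFunction = W.entireLFunction := by
      unfold WeierstrassCurve.entireLFunction
      rw [hEC, hLS]
    simp only [WeierstrassCurve.analyticRank, hEL]
  -- Selmer-rank BSD at ONE prime on a global minimal model, in three sectors (verbatim from `closes`)
  have hmin : ∀ (V : WeierstrassCurve ℚ) [V.IsElliptic] [V.IsGloballyMinimal],
      ∃ (p : ℕ) (_ : Fact p.Prime), V.selmerCorank p = V.analyticRank := by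
    intro V _ _
    by_cases hm : ∃ (q : ℕ) (_ : Fact q.Prime), V.HasMultiplicativeReductionAtPrime q
    · obtain ⟨p, hp, Nplus, Nminus, m, a, b, O, K, hFK, hNK, ψ, I, φ, rep, RI, σ, dlog, hC, k, hkr,
        hkp, hndvd⟩ := hK1 V hm
      obtain ⟨⟨h5, hgood, hord, hsurj, hq2, hj⟩, hrest⟩ := hC
      have hk : V.selmerCorank p ≤ k :=
        hK2 V p Nplus Nminus m a b O K ψ I φ rep RI σ dlog ⟨⟨h5, hgood, hord, hsurj, hq2, hj⟩, hrest⟩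
          k hkp hndvd
      have hUB : V.selmerCorank p ≤ V.analyticRank := hk.trans hkr
      exact ⟨p, hp, le_antisymm hUB (hLB V p h5 hgood hord hsurj)⟩
    · by_cases hW : V.HasCM
      · obtain ⟨p, hp, h5, hgood, hord⟩ := WeierstrassCurve.exists_good_ordinary_prime_holds V
        exact ⟨p, hp, hCM V p h5 hgood hord hW⟩
      · obtain ⟨p, hp, h5, hgood, hord, hsurj⟩ := hSerre V hW
        exact ⟨p, hp, le_antisymm (hPG V hm p h5 hgood hord hsurj) (hLB V p h5 hgood hord hsurj)⟩
  -- NEW TAIL: BSD-rank on the global minimal model from the restated Ш-input, transported to `W`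
  intro W hW
  obtain ⟨C, hC⟩ := WeierstrassCurve.hasGlobalMinimalModel_rat_holds W
  obtain ⟨p, hp, hminp⟩ := hmin (C • W)
  have h2 : (C • W).selmerCorank p = (C • W).mordellWeilRank + (C • W).shaCorank p := hId (C • W) p
  have h4 : (C • W).shaCorank p = 0 := hZ (C • W) p (hSha (C • W) p hminp)
  have h6 := hMW W C
  have h7 := hAn W C
  omega

/-- Hence FrozenTwin's Assembly with the crux slot weakened to the restatement is closable, and a fortiori
the filed Assembly (the crux implies the restatement). -/
theorem closes_via_restatement (hK1 : GrossMomentSharpness) (hK2 : FrozenTwinBound)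
    (hPG : UBPotentiallyGood) (hLB : SelmerRankLB) (hSha : FrozenTwin.SelmerRankShaPFinite)
    (hCM : SelmerRankCM) (hSerre : SerrePrimeSupply) : _root_.BirchSwinnertonDyer :=
  closes_of_shaPFiniteAtCertifiedPrime hK1 hK2 hPG hLB (shaPFiniteAtCertifiedPrime_of_crux hSha) hCM hSerre

end Summit.BirchSwinnertonDyer.BirchSwinnertonDyer.Cruxes.SelmerRankShaPFinite.IdeateR2K4LineAudit
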